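import Summits.QuantumFields.QCD.Theorems.QuarksAsStableActionStableActionBridgeWilsonSliceReduction
import Summits.QuantumFields.QCD.Theorems.QuarksAsStableActionStableActionBridgeSliceMassHopPosDef
import Summits.QuantumFields.QCD.Theorems.QuarksAsStableActionStableActionBridgeTimeKernelPosDef
import Summits.QuantumFields.QCD.Theorems.QuarksAsStableActionStableActionBridgeChainBlockInverse
import Summits.QuantumFields.QCD.Theorems.QuarksAsStableActionStableActionBridgeDressedTransferTwo
import Summits.QuantumFields.QCD.Theorems.QuarksAsStableActionStableActionBridgeDressedCorePosDef
import Summits.QuantumFields.QCD.Theorems.QuarksAsStableActionStableActionBridgeCyclicUndressing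

/-!
# Lüscher's transfer-matrix form of the Wilson fermion determinant (F3, fermionic trace formula)
(crux `QuarksAsStableAction.StableActionBridge`, item stmt-QuantumFields-9737, line `Sketch`; lead theorem of
continuation lead c3, cycle 4, `--supports stmt-QuantumFields-9737`; registered sub-goal `wilson_det_transfer_form`)

For every unitary representation `ρ`, every gauge field `U` on `(ℤ/L)⁴` (`L ≥ 1`) and every bare mass `m > −1`:
`det D_W[U] = (∏_t det E_t) · det(1 − ∏_{t=0}^{L−1} M_t W_t)`, where `W_t = ρ(U((t,·),0)) ⊗ 1_spin` are the unitary
temporal transporters, `M_t = (1 + P⁺C_tP⁻)(B̂_tP⁺ + B̂_t⁻¹P⁻)(1 − P⁻C_tP⁺)` is HERMITIAN POSITIVE DEFINITE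
(`B̂_t = B_t ⊗ 1`, `B_t = (m+4)·1 − ½Σ_j(H_j + H_jᴴ) > 0`, `C_t = A_t − B̂_t` anti-Hermitian, `P± = ½(1 ± γ₀)`), and
`E_t = A_tP⁻ − P⁺W′_{t−1}` are the chain blocks of the time-slice reduction (p118384).  By `trace_fockLift` (p119264)
the second factor is the `(−1)^F`-twisted Fock trace `Tr[Γ(−1) ∏_t Γ(M_t)Γ(W_t)]` of an ordered product of POSITIVE
one-step transfer matrices and unitary gauge transporters (Lüscher 1977); sign-flipped seam links give the trace.
Assembly of p118384, p119771 (explicit `E_t⁻¹`), p120153 (dressed one-step matrix), p119842 (positivity of the core),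
p119981 (cyclic undressing); the slice-level inputs `P⁺A_tP⁺ = B̂_tP⁺`, `C_tᴴ = −C_t`, `P±ᴴ = P±`, `B̂_t > 0` are
proved here in Kronecker form as in p117675.  References: [Luscher1977, pp. 283–292]; [Smit2023, §6.5 (6.84)–(6.91)];
[MontvayMunster1994, §4.2.3 (4.111)].
-/

noncomputable section

namespace Summit.QuantumFields.QCD.Cruxes.StableActionBridge.Sketch

open scoped ComplexOrder
open Literature.MathematicalPhysics.QuantumLattice Literature.MathematicalPhysics.QuantumFieldTheory
open Literature.Probability.LatticeModels (TorusSite)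

namespace WilsonTransfer

open Matrix
open scoped Kronecker

/-! ### The `4 × 4` spin algebra of `P⁺ = ½ (1 + γ₀)` -/

/-- `P⁺ = ½ (1 + γ₀)` is idempotent (`γ₀² = 1`). -/
theorem projPlus_mul_self :
    (1 / 2 : ℂ) • (1 + euclideanGamma 0) * ((1 / 2 : ℂ) • (1 + euclideanGamma 0)) =
      (1 / 2 : ℂ) • (1 + euclideanGamma 0) := by
  rw [Matrix.smul_mul, Matrix.mul_smul, smul_smul, add_mul, one_mul, mul_add, mul_one,
    euclideanGamma_mul_self]
  module

/-- `P⁺ γ_k P⁺ = 0` for the spatial gamma matrices `γ_k = euclideanGamma j.succ`: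
`(1 + γ₀) γ_k (1 + γ₀) = γ_k (1 − γ₀)(1 + γ₀) = 0`. -/
theorem projPlus_mul_gamma_mul_projPlus (j : Fin 3) :
    (1 / 2 : ℂ) • (1 + euclideanGamma 0) * euclideanGamma j.succ *
        ((1 / 2 : ℂ) • (1 + euclideanGamma 0)) = 0 := by
  have h0 : euclideanGamma 0 * euclideanGamma j.succ =
      -(euclideanGamma j.succ * euclideanGamma 0) :=
    euclideanGamma_mul_of_ne (Fin.succ_ne_zero j).symm
  have h : ((1 : Matrix (Fin 4) (Fin 4) ℂ) + euclideanGamma 0) * euclideanGamma j.succ *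
      (1 + euclideanGamma 0) = 0 := by
    rw [add_mul, one_mul, h0, add_mul, neg_mul, mul_add, mul_add, mul_one, mul_one,
      Matrix.mul_assoc (euclideanGamma j.succ), euclideanGamma_mul_self, mul_one]
    abel
  rw [Matrix.smul_mul, Matrix.smul_mul, Matrix.mul_smul, h, smul_zero, smul_zero]

/-- `P⁺` is Hermitian. -/
theorem projPlus_conjTranspose :
    ((1 / 2 : ℂ) • ((1 : Matrix (Fin 4) (Fin 4) ℂ) + euclideanGamma 0))ᴴ =
      (1 / 2 : ℂ) • (1 + euclideanGamma 0) := by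
  rw [conjTranspose_smul, conjTranspose_add, conjTranspose_one, (euclideanGamma_isHermitian 0).eq,
    TimeKernelPosDef.star_one_half]

/-- `P⁻` is Hermitian. -/
theorem projMinus_conjTranspose :
    ((1 / 2 : ℂ) • ((1 : Matrix (Fin 4) (Fin 4) ℂ) - euclideanGamma 0))ᴴ =
      (1 / 2 : ℂ) • (1 - euclideanGamma 0) := by
  rw [conjTranspose_smul, conjTranspose_sub, conjTranspose_one, (euclideanGamma_isHermitian 0).eq,
    TimeKernelPosDef.star_one_half]

/-- Complementary annihilating summands of `1` are idempotent: `P + Q = 1`, `P Q = 0` give `P² = P`. -/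
theorem mul_self_of_add_eq_one {n : Type*} [Fintype n] [DecidableEq n] {P Q : Matrix n n ℂ}
    (h1 : P + Q = 1) (h0 : P * Q = 0) : P * P = P := by
  have h : P * (P + Q) = P := by rw [h1, mul_one]
  rwa [mul_add, h0, add_zero] at h

/-- If `P A P = Bh P`, `Bh` commutes with `P` and `P² = P`, then `P (A − Bh) P = 0`. -/
theorem proj_sub_proj_eq_zero {n : Type*} [Fintype n] {P A Bh : Matrix n n ℂ}
    (h : P * A * P = Bh * P) (hc : Bh * P = P * Bh) (hPP : P * P = P) : P * (A - Bh) * P = 0 := by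
  rw [mul_sub, sub_mul, h, ← hc, Matrix.mul_assoc, hPP, sub_self]

/-- `∏_{i ∈ l} (−X_i) = (−1)^{|l|} · ∏_{i ∈ l} X_i` for an ordered product of matrices. -/
theorem prod_map_neg_eq_smul {n : Type*} [Fintype n] [DecidableEq n] (X : ℕ → Matrix n n ℂ) :
    ∀ l : List ℕ, (l.map fun i => -X i).prod = (-1 : ℂ) ^ l.length • (l.map X).prod
  | [] => by simp
  | a :: l => by
    rw [List.map_cons, List.prod_cons, prod_map_neg_eq_smul X l, List.map_cons, List.prod_cons,
      List.length_cons, Matrix.mul_smul, neg_mul, smul_neg, pow_succ, mul_neg_one, neg_smul]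

/-! ### Kronecker form of the slice-level claims -/

section KroneckerClaims

variable {X Y : Type*} [Fintype X] [DecidableEq X] [Fintype Y] [DecidableEq Y]

omit [Fintype X] [DecidableEq X] [Fintype Y] [DecidableEq Y] in
/-- `(−C) ⊗ S = −(C ⊗ S)`. -/
theorem neg_kronecker (C : Matrix (X × Y) (X × Y) ℂ) (S : Matrix (Fin 4) (Fin 4) ℂ) :
    (-C) ⊗ₖ S = -(C ⊗ₖ S) := by
  ext a b
  simp only [Matrix.kroneckerMap_apply, Matrix.neg_apply, neg_mul]

/-- Conjugate transposition commutes with the reassociation `reindexAlgEquiv`. -/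
theorem conjTranspose_reindexAlgEquiv (M : Matrix ((X × Y) × Fin 4) ((X × Y) × Fin 4) ℂ) :
    (Matrix.reindexAlgEquiv ℂ ℂ (Equiv.prodAssoc X Y (Fin 4)) M)ᴴ =
      Matrix.reindexAlgEquiv ℂ ℂ (Equiv.prodAssoc X Y (Fin 4)) Mᴴ :=
  Matrix.conjTranspose_reindex _ _ M

/-- **Kronecker form of the four slice claims.**  With `Pp = 1 ⊗ P⁺`, `Pm = 1 ⊗ P⁻`,
`A = B ⊗ 1 + Σ_j C_j ⊗ γ_{j+1}`, `Bh = B ⊗ 1` (transported along `Equiv.prodAssoc`), anti-Hermitian `C_j`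
and positive definite `B`: `Pp A Pp = Bh Pp`, `(A − Bh)ᴴ = −(A − Bh)`, `Ppᴴ = Pp`, `Pmᴴ = Pm`, `Bh > 0`. -/
theorem kronecker_claims_plus (B : Matrix (X × Y) (X × Y) ℂ) (C : Fin 3 → Matrix (X × Y) (X × Y) ℂ)
    (hC : ∀ j, (C j)ᴴ = -C j) (hB : B.PosDef) :
    Matrix.reindexAlgEquiv ℂ ℂ (Equiv.prodAssoc X Y (Fin 4))
            ((1 : Matrix (X × Y) (X × Y) ℂ) ⊗ₖ ((1 / 2 : ℂ) • (1 + euclideanGamma 0))) *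
          Matrix.reindexAlgEquiv ℂ ℂ (Equiv.prodAssoc X Y (Fin 4))
            (B ⊗ₖ (1 : Matrix (Fin 4) (Fin 4) ℂ) + ∑ j : Fin 3, C j ⊗ₖ euclideanGamma j.succ) *
          Matrix.reindexAlgEquiv ℂ ℂ (Equiv.prodAssoc X Y (Fin 4))
            ((1 : Matrix (X × Y) (X × Y) ℂ) ⊗ₖ ((1 / 2 : ℂ) • (1 + euclideanGamma 0))) =
        Matrix.reindexAlgEquiv ℂ ℂ (Equiv.prodAssoc X Y (Fin 4))
            (B ⊗ₖ (1 : Matrix (Fin 4) (Fin 4) ℂ)) *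
          Matrix.reindexAlgEquiv ℂ ℂ (Equiv.prodAssoc X Y (Fin 4))
            ((1 : Matrix (X × Y) (X × Y) ℂ) ⊗ₖ ((1 / 2 : ℂ) • (1 + euclideanGamma 0))) ∧
      (Matrix.reindexAlgEquiv ℂ ℂ (Equiv.prodAssoc X Y (Fin 4))
            (B ⊗ₖ (1 : Matrix (Fin 4) (Fin 4) ℂ) + ∑ j : Fin 3, C j ⊗ₖ euclideanGamma j.succ) -
          Matrix.reindexAlgEquiv ℂ ℂ (Equiv.prodAssoc X Y (Fin 4))
            (B ⊗ₖ (1 : Matrix (Fin 4) (Fin 4) ℂ)))ᴴ =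
        -(Matrix.reindexAlgEquiv ℂ ℂ (Equiv.prodAssoc X Y (Fin 4))
            (B ⊗ₖ (1 : Matrix (Fin 4) (Fin 4) ℂ) + ∑ j : Fin 3, C j ⊗ₖ euclideanGamma j.succ) -
          Matrix.reindexAlgEquiv ℂ ℂ (Equiv.prodAssoc X Y (Fin 4))
            (B ⊗ₖ (1 : Matrix (Fin 4) (Fin 4) ℂ))) ∧
      (Matrix.reindexAlgEquiv ℂ ℂ (Equiv.prodAssoc X Y (Fin 4))
            ((1 : Matrix (X × Y) (X × Y) ℂ) ⊗ₖ ((1 / 2 : ℂ) • (1 + euclideanGamma 0))))ᴴ =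
        Matrix.reindexAlgEquiv ℂ ℂ (Equiv.prodAssoc X Y (Fin 4))
            ((1 : Matrix (X × Y) (X × Y) ℂ) ⊗ₖ ((1 / 2 : ℂ) • (1 + euclideanGamma 0))) ∧
      (Matrix.reindexAlgEquiv ℂ ℂ (Equiv.prodAssoc X Y (Fin 4))
            ((1 : Matrix (X × Y) (X × Y) ℂ) ⊗ₖ ((1 / 2 : ℂ) • (1 - euclideanGamma 0))))ᴴ =
        Matrix.reindexAlgEquiv ℂ ℂ (Equiv.prodAssoc X Y (Fin 4))
            ((1 : Matrix (X × Y) (X × Y) ℂ) ⊗ₖ ((1 / 2 : ℂ) • (1 - euclideanGamma 0))) ∧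
      (Matrix.reindexAlgEquiv ℂ ℂ (Equiv.prodAssoc X Y (Fin 4))
            (B ⊗ₖ (1 : Matrix (Fin 4) (Fin 4) ℂ))).PosDef := by
  refine ⟨?_, ?_, ?_, ?_, ?_⟩
  · -- `Pp A Pp = Bh Pp`
    rw [← map_mul, ← map_mul, ← map_mul]
    congr 1
    rw [mul_add, add_mul, Finset.mul_sum, Finset.sum_mul]
    simp only [← Matrix.mul_kronecker_mul, Matrix.one_mul, Matrix.mul_one, projPlus_mul_self,
      projPlus_mul_gamma_mul_projPlus, Matrix.kronecker_zero, Finset.sum_const_zero, add_zero]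
  · -- `(A − Bh)ᴴ = −(A − Bh)`
    rw [← map_sub, add_sub_cancel_left, conjTranspose_reindexAlgEquiv, ← map_neg, Matrix.conjTranspose_sum,
      ← Finset.sum_neg_distrib]
    congr 1
    refine Finset.sum_congr rfl fun j _ => ?_
    rw [Matrix.conjTranspose_kronecker, hC j, (euclideanGamma_isHermitian j.succ).eq, neg_kronecker]
  · -- `Ppᴴ = Pp`
    rw [conjTranspose_reindexAlgEquiv, Matrix.conjTranspose_kronecker, conjTranspose_one, projPlus_conjTranspose]
  · -- `Pmᴴ = Pm`
    rw [conjTranspose_reindexAlgEquiv, Matrix.conjTranspose_kronecker, conjTranspose_one, projMinus_conjTranspose]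
  · -- `Bh > 0`
    exact (hB.kronecker Matrix.PosDef.one).submatrix (Equiv.prodAssoc X Y (Fin 4)).symm.injective

end KroneckerClaims

/-! ### The slice-level claims for the literal Wilson slice matrices -/

variable {Nc L : ℕ} [NeZero L] {G : Type*} [Group G] (ρ : G →* Matrix (Fin Nc) (Fin Nc) ℂ)

omit [NeZero L] in
/-- The spatial Wilson–Dirac hopping coefficient `C_j = ½ (H_j − H_j⁻)` is anti-Hermitian for a unitary
representation (`H_j⁻ = H_jᴴ`). -/
theorem hopDiff_conjTranspose (hρ : ∀ g, ρ g ∈ Matrix.unitaryGroup (Fin Nc) ℂ) (U : GaugeConfig 4 L G)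
    (t : ZMod L) (j : Fin 3) :
    (Matrix.of fun p q : TorusSite 3 L × Fin Nc =>
        (1 / 2 : ℂ) *
          ((if q.1 = Literature.MathematicalPhysics.QuantumFieldTheory.Site.shift p.1 j then
              ρ (U ((Fin.cons t p.1 : TorusSite 4 L), j.succ)) p.2 q.2 else 0) -
            (if p.1 = Literature.MathematicalPhysics.QuantumFieldTheory.Site.shift q.1 j then
              ρ (U ((Fin.cons t q.1 : TorusSite 4 L), j.succ))⁻¹ p.2 q.2 else 0)))ᴴ =
      -(Matrix.of fun p q : TorusSite 3 L × Fin Nc =>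
        (1 / 2 : ℂ) *
          ((if q.1 = Literature.MathematicalPhysics.QuantumFieldTheory.Site.shift p.1 j then
              ρ (U ((Fin.cons t p.1 : TorusSite 4 L), j.succ)) p.2 q.2 else 0) -
            (if p.1 = Literature.MathematicalPhysics.QuantumFieldTheory.Site.shift q.1 j then
              ρ (U ((Fin.cons t q.1 : TorusSite 4 L), j.succ))⁻¹ p.2 q.2 else 0))) := by
  have hsplit : (Matrix.of fun p q : TorusSite 3 L × Fin Nc =>
        (1 / 2 : ℂ) *
          ((if q.1 = Literature.MathematicalPhysics.QuantumFieldTheory.Site.shift p.1 j then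
              ρ (U ((Fin.cons t p.1 : TorusSite 4 L), j.succ)) p.2 q.2 else 0) -
            (if p.1 = Literature.MathematicalPhysics.QuantumFieldTheory.Site.shift q.1 j then
              ρ (U ((Fin.cons t q.1 : TorusSite 4 L), j.succ))⁻¹ p.2 q.2 else 0))) =
      (1 / 2 : ℂ) •
        ((Matrix.of fun a b : TorusSite 3 L × Fin Nc =>
            if b.1 = Site.shift a.1 j then ρ (U ((Fin.cons t a.1 : TorusSite 4 L), j.succ)) a.2 b.2 else 0) -
          (Matrix.of fun a b : TorusSite 3 L × Fin Nc =>
            if a.1 = Site.shift b.1 j then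
              ρ (U ((Fin.cons t b.1 : TorusSite 4 L), j.succ))⁻¹ a.2 b.2 else 0)) := by
    ext a b
    simp only [of_apply, Matrix.smul_apply, Matrix.sub_apply, smul_eq_mul]
  rw [hsplit, SliceMassHop.hopBack_eq_conjTranspose ρ hρ U t j, conjTranspose_smul, conjTranspose_sub,
    conjTranspose_conjTranspose, TimeKernelPosDef.star_one_half, ← smul_neg, neg_sub]

/-- **Positivity of the spin-blind slice operator** `B_t = (m+4)·1 − ½ Σ_j (H_j + H_j⁻)` for a unitary
representation and `m > −1`: the hops are isometries and `3 < m + 4`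
(`SliceMassHopPosDef.posDef_diagonal_sub_hopSum`). [cite: MontvayMunster1994, §4.2.3 (4.111)] -/
theorem sliceOp_posDef (hρ : ∀ g, ρ g ∈ Matrix.unitaryGroup (Fin Nc) ℂ) (U : GaugeConfig 4 L G) {m : ℝ}
    (hm : -1 < m) (t : ZMod L) :
    (Matrix.of fun a b : TorusSite 3 L × Fin Nc =>
        (if a = b then ((m + 4 : ℝ) : ℂ) else 0) -
          (1 / 2 : ℂ) * ∑ j : Fin 3,
            ((if b.1 = Literature.MathematicalPhysics.QuantumFieldTheory.Site.shift a.1 j then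
                ρ (U ((Fin.cons t a.1 : TorusSite 4 L), j.succ)) a.2 b.2 else 0) +
              (if a.1 = Literature.MathematicalPhysics.QuantumFieldTheory.Site.shift b.1 j then
                ρ (U ((Fin.cons t b.1 : TorusSite 4 L), j.succ))⁻¹ a.2 b.2 else 0))).PosDef := by
  rw [SliceMassHop.sliceOp_eq ρ U m t]
  simp_rw [SliceMassHop.hopBack_eq_conjTranspose ρ hρ U t]
  rw [Matrix.smul_one_eq_diagonal]
  exact SliceMassHopPosDef.posDef_diagonal_sub_hopSum
    (fun j : Fin 3 => Matrix.of fun a b : TorusSite 3 L × Fin Nc =>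
      if b.1 = Site.shift a.1 j then ρ (U ((Fin.cons t a.1 : TorusSite 4 L), j.succ)) a.2 b.2 else 0)
    (fun j => SliceMassHop.conjTranspose_mul_hop ρ hρ U t j) (fun _ => m + 4)
    (fun _ => by simp only [Fintype.card_fin]; push_cast; linarith)

/-- **The slice-level claims** for the literal Wilson slice matrices at time `t` (unitary `ρ`, `m > −1`):
`P⁺ A_t P⁺ = B̂_t P⁺`, `(A_t − B̂_t)ᴴ = −(A_t − B̂_t)`, `P±ᴴ = P±`, and `B̂_t > 0`. -/
theorem slice_claims (hρ : ∀ g, ρ g ∈ Matrix.unitaryGroup (Fin Nc) ℂ) (U : GaugeConfig 4 L G) (m : ℝ)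
    (hm : -1 < m) (t : ZMod L) :
    let Pp : Matrix (TorusSite 3 L × Fin Nc × Fin 4) (TorusSite 3 L × Fin Nc × Fin 4) ℂ := Matrix.of fun a b =>
      if a.1 = b.1 ∧ a.2.1 = b.2.1 then ((1 / 2 : ℂ) • (1 + euclideanGamma 0)) a.2.2 b.2.2 else 0;
    let Pm : Matrix (TorusSite 3 L × Fin Nc × Fin 4) (TorusSite 3 L × Fin Nc × Fin 4) ℂ := Matrix.of fun a b =>
      if a.1 = b.1 ∧ a.2.1 = b.2.1 then ((1 / 2 : ℂ) • (1 - euclideanGamma 0)) a.2.2 b.2.2 else 0;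
    let A : Matrix (TorusSite 3 L × Fin Nc × Fin 4) (TorusSite 3 L × Fin Nc × Fin 4) ℂ :=
      Matrix.of fun a b =>
        (if a = b then ((m + 4 * 1 : ℝ) : ℂ) else 0) -
          (1 / 2 : ℂ) * ∑ j : Fin 3,
            ((if b.1 = Literature.MathematicalPhysics.QuantumFieldTheory.Site.shift a.1 j then
                (((1 : ℝ) : ℂ) • (1 : Matrix (Fin 4) (Fin 4) ℂ) - euclideanGamma j.succ) a.2.2 b.2.2 *
                  ρ (U ((Fin.cons t a.1 : TorusSite 4 L), j.succ)) a.2.1 b.2.1 else 0) +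
              (if a.1 = Literature.MathematicalPhysics.QuantumFieldTheory.Site.shift b.1 j then
                (((1 : ℝ) : ℂ) • (1 : Matrix (Fin 4) (Fin 4) ℂ) + euclideanGamma j.succ) a.2.2 b.2.2 *
                  ρ (U ((Fin.cons t b.1 : TorusSite 4 L), j.succ))⁻¹ a.2.1 b.2.1 else 0));
    let B : Matrix (TorusSite 3 L × Fin Nc) (TorusSite 3 L × Fin Nc) ℂ := Matrix.of fun a b =>
        (if a = b then ((m + 4 : ℝ) : ℂ) else 0) -
          (1 / 2 : ℂ) * ∑ j : Fin 3,
            ((if b.1 = Literature.MathematicalPhysics.QuantumFieldTheory.Site.shift a.1 j then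
                ρ (U ((Fin.cons t a.1 : TorusSite 4 L), j.succ)) a.2 b.2 else 0) +
              (if a.1 = Literature.MathematicalPhysics.QuantumFieldTheory.Site.shift b.1 j then
                ρ (U ((Fin.cons t b.1 : TorusSite 4 L), j.succ))⁻¹ a.2 b.2 else 0));
    let Bh : Matrix (TorusSite 3 L × Fin Nc × Fin 4) (TorusSite 3 L × Fin Nc × Fin 4) ℂ := Matrix.of fun a b =>
        if a.2.2 = b.2.2 then B (a.1, a.2.1) (b.1, b.2.1) else 0;
    Pp * A * Pp = Bh * Pp ∧ (A - Bh)ᴴ = -(A - Bh) ∧ Ppᴴ = Pp ∧ Pmᴴ = Pm ∧ Bh.PosDef := by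
  intro Pp Pm A B Bh
  have hPp : Pp = Matrix.reindexAlgEquiv ℂ ℂ (Equiv.prodAssoc (TorusSite 3 L) (Fin Nc) (Fin 4))
      ((1 : Matrix (TorusSite 3 L × Fin Nc) (TorusSite 3 L × Fin Nc) ℂ) ⊗ₖ
        ((1 / 2 : ℂ) • (1 + euclideanGamma 0))) :=
    SliceSpin.of_spin_eq ((1 / 2 : ℂ) • (1 + euclideanGamma 0))
  have hPm : Pm = Matrix.reindexAlgEquiv ℂ ℂ (Equiv.prodAssoc (TorusSite 3 L) (Fin Nc) (Fin 4))
      ((1 : Matrix (TorusSite 3 L × Fin Nc) (TorusSite 3 L × Fin Nc) ℂ) ⊗ₖ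
        ((1 / 2 : ℂ) • (1 - euclideanGamma 0))) :=
    SliceSpin.of_spin_eq ((1 / 2 : ℂ) • (1 - euclideanGamma 0))
  have hBh : Bh = Matrix.reindexAlgEquiv ℂ ℂ (Equiv.prodAssoc (TorusSite 3 L) (Fin Nc) (Fin 4))
      (B ⊗ₖ (1 : Matrix (Fin 4) (Fin 4) ℂ)) :=
    SliceSpin.of_spinDiag_eq B
  have hA : A = Matrix.reindexAlgEquiv ℂ ℂ (Equiv.prodAssoc (TorusSite 3 L) (Fin Nc) (Fin 4))
      (B ⊗ₖ (1 : Matrix (Fin 4) (Fin 4) ℂ) +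
        ∑ j : Fin 3,
          (Matrix.of fun p q : TorusSite 3 L × Fin Nc =>
            (1 / 2 : ℂ) *
              ((if q.1 = Literature.MathematicalPhysics.QuantumFieldTheory.Site.shift p.1 j then
                  ρ (U ((Fin.cons t p.1 : TorusSite 4 L), j.succ)) p.2 q.2 else 0) -
                (if p.1 = Literature.MathematicalPhysics.QuantumFieldTheory.Site.shift q.1 j then
                  ρ (U ((Fin.cons t q.1 : TorusSite 4 L), j.succ))⁻¹ p.2 q.2 else 0))) ⊗ₖ
            euclideanGamma j.succ) := by
    simp only [A, B, mul_one, Complex.ofReal_one, one_smul]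
    exact SliceSpin.sliceOp_eq ((m + 4 : ℝ) : ℂ)
      (fun x j => Literature.MathematicalPhysics.QuantumFieldTheory.Site.shift x j)
      (fun j x => ρ (U ((Fin.cons t x : TorusSite 4 L), j.succ)))
      (fun j y => ρ (U ((Fin.cons t y : TorusSite 4 L), j.succ))⁻¹) (fun j => euclideanGamma j.succ)
  have hB : B.PosDef := sliceOp_posDef ρ hρ U hm t
  rw [hPp, hPm, hA, hBh]
  exact kronecker_claims_plus B _ (fun j => hopDiff_conjTranspose ρ hρ U t j) hB

end WilsonTransfer

/-- **Lüscher's transfer-matrix form of the Wilson fermion determinant** (registered sub-goal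
`wilson_det_transfer_form` of crux stmt-QuantumFields-9737): for unitary `ρ`, every `U` on `(ℤ/L)⁴` and `m > −1`,
`det D_W[U] = (∏_t det E_t) · det(1 − ∏_t M_t W_t)` with every one-step matrix `M_t` Hermitian positive definite and
`W_t` the unitary temporal transporters (see the module docstring).
[cite: Luscher1977, pp. 283–292] [cite: Smit2023, §6.5 (6.84)–(6.91)] [cite: MontvayMunster1994, §4.2.3 (4.111)] -/
theorem wilson_det_transfer_form :
    ∀ (Nc L : ℕ) [NeZero L] (G : Type) [Group G] (ρ : G →* Matrix (Fin Nc) (Fin Nc) ℂ),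
      (∀ g, ρ g ∈ Matrix.unitaryGroup (Fin Nc) ℂ) → ∀ (U : GaugeConfig 4 L G) (m : ℝ), -1 < m →
      let Pp : Matrix (TorusSite 3 L × Fin Nc × Fin 4) (TorusSite 3 L × Fin Nc × Fin 4) ℂ := Matrix.of fun a b =>
        if a.1 = b.1 ∧ a.2.1 = b.2.1 then ((1 / 2 : ℂ) • (1 + euclideanGamma 0)) a.2.2 b.2.2 else 0;
      let Pm : Matrix (TorusSite 3 L × Fin Nc × Fin 4) (TorusSite 3 L × Fin Nc × Fin 4) ℂ := Matrix.of fun a b =>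
        if a.1 = b.1 ∧ a.2.1 = b.2.1 then ((1 / 2 : ℂ) • (1 - euclideanGamma 0)) a.2.2 b.2.2 else 0;
      let W : ZMod L → Matrix (TorusSite 3 L × Fin Nc × Fin 4) (TorusSite 3 L × Fin Nc × Fin 4) ℂ := fun t =>
        Matrix.of fun a b => if a.1 = b.1 ∧ a.2.2 = b.2.2 then
          ρ (U ((Fin.cons t a.1 : TorusSite 4 L), 0)) a.2.1 b.2.1 else 0;
      let W' : ZMod L → Matrix (TorusSite 3 L × Fin Nc × Fin 4) (TorusSite 3 L × Fin Nc × Fin 4) ℂ := fun t =>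
        Matrix.of fun a b => if a.1 = b.1 ∧ a.2.2 = b.2.2 then
          ρ (U ((Fin.cons t a.1 : TorusSite 4 L), 0))⁻¹ a.2.1 b.2.1 else 0;
      let A : ZMod L → Matrix (TorusSite 3 L × Fin Nc × Fin 4) (TorusSite 3 L × Fin Nc × Fin 4) ℂ := fun t =>
        Matrix.of fun a b =>
          (if a = b then ((m + 4 * 1 : ℝ) : ℂ) else 0) -
            (1 / 2 : ℂ) * ∑ j : Fin 3,
              ((if b.1 = Literature.MathematicalPhysics.QuantumFieldTheory.Site.shift a.1 j then
                  (((1 : ℝ) : ℂ) • (1 : Matrix (Fin 4) (Fin 4) ℂ) - euclideanGamma j.succ) a.2.2 b.2.2 *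
                    ρ (U ((Fin.cons t a.1 : TorusSite 4 L), j.succ)) a.2.1 b.2.1 else 0) +
                (if a.1 = Literature.MathematicalPhysics.QuantumFieldTheory.Site.shift b.1 j then
                  (((1 : ℝ) : ℂ) • (1 : Matrix (Fin 4) (Fin 4) ℂ) + euclideanGamma j.succ) a.2.2 b.2.2 *
                    ρ (U ((Fin.cons t b.1 : TorusSite 4 L), j.succ))⁻¹ a.2.1 b.2.1 else 0));
      let B : ZMod L → Matrix (TorusSite 3 L × Fin Nc) (TorusSite 3 L × Fin Nc) ℂ := fun t => Matrix.of fun a b =>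
          (if a = b then ((m + 4 : ℝ) : ℂ) else 0) -
            (1 / 2 : ℂ) * ∑ j : Fin 3,
              ((if b.1 = Literature.MathematicalPhysics.QuantumFieldTheory.Site.shift a.1 j then
                  ρ (U ((Fin.cons t a.1 : TorusSite 4 L), j.succ)) a.2 b.2 else 0) +
                (if a.1 = Literature.MathematicalPhysics.QuantumFieldTheory.Site.shift b.1 j then
                  ρ (U ((Fin.cons t b.1 : TorusSite 4 L), j.succ))⁻¹ a.2 b.2 else 0));
      let Bh : ZMod L → Matrix (TorusSite 3 L × Fin Nc × Fin 4) (TorusSite 3 L × Fin Nc × Fin 4) ℂ := fun t =>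
        Matrix.of fun a b => if a.2.2 = b.2.2 then B t (a.1, a.2.1) (b.1, b.2.1) else 0;
      let M : ZMod L → Matrix (TorusSite 3 L × Fin Nc × Fin 4) (TorusSite 3 L × Fin Nc × Fin 4) ℂ := fun t =>
        (1 + Pp * (A t - Bh t) * Pm) * (Bh t * Pp + (Bh t)⁻¹ * Pm) * (1 - Pm * (A t - Bh t) * Pp);
      (wilsonDirac ρ U m 1).det =
          (∏ t : ZMod L, (A t * Pm - Pp * W' (t - 1)).det) *
            (1 - ((List.range L).map fun i : ℕ => M (i : ZMod L) * W (i : ZMod L)).prod).det ∧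
        ∀ t : ZMod L, (M t).PosDef := by
  intro Nc L _ G _ ρ hρ U m hm Pp Pm W W' A B Bh M
  have hP : Pp + Pm = 1 := liftProjPlus_add_liftProjMinus (TorusSite 3 L) Nc
  have hPQ : Pp * Pm = 0 := liftProjPlus_mul_liftProjMinus (TorusSite 3 L) Nc
  have hQP : Pm * Pp = 0 := liftProjMinus_mul_liftProjPlus (TorusSite 3 L) Nc
  have hPP : Pp * Pp = Pp := WilsonTransfer.mul_self_of_add_eq_one hP hPQ
  have hQQ : Pm * Pm = Pm := WilsonTransfer.mul_self_of_add_eq_one ((add_comm Pm Pp).trans hP) hQP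
  have hspin := fun t : ZMod L => wilsonSlice_spin_structure Nc L G ρ U m t
  have hplus := fun t : ZMod L => WilsonTransfer.slice_claims ρ hρ U m hm t
  have hdetBh : ∀ t : ZMod L, IsUnit (Bh t).det := fun t => by
    rw [(hspin t).2.2.2.1]
    exact (isUnit_det_sliceMassHop Nc L G ρ hρ U m hm t).pow 4
  have hCpp : ∀ t : ZMod L, Pp * (A t - Bh t) * Pp = 0 := fun t =>
    WilsonTransfer.proj_sub_proj_eq_zero (hplus t).1 (hspin t).2.2.1 hPP
  have hCmm : ∀ t : ZMod L, Pm * (A t - Bh t) * Pm = 0 := fun t =>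
    WilsonTransfer.proj_sub_proj_eq_zero (hspin t).1 (hspin t).2.1 hQQ
  -- (2) the explicit inverse of the chain block (p119771)
  have hEinv : ∀ t : ZMod L, (A t * Pm - Pp * W' (t - 1))⁻¹ =
      -(W (t - 1) * Pp) + W (t - 1) * Pp * (A t - Bh t) * (Bh t)⁻¹ * Pm + (Bh t)⁻¹ * Pm := fun t => by
    refine Matrix.inv_eq_right_inv ?_
    have h := projChainBlock_mul_explicitInv _ Pp Pm (Bh t) (A t - Bh t) (W (t - 1)) (W' (t - 1)) hP hPP hQQ
      hPQ hQP (hspin t).2.2.1 (hspin t).2.1 (hCmm t) (hspin (t - 1)).2.2.2.2.2.2.1 (hspin (t - 1)).2.2.2.2.2.1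
      (hspin (t - 1)).2.2.2.2.2.2.2.2 (hdetBh t)
    rwa [add_sub_cancel] at h
  -- (3) the dressed one-step matrices (two-transporter form of p119952)
  have hstep : ∀ t : ZMod L, (A t * Pm - Pp * W' (t - 1))⁻¹ * (A t * Pp - Pm * W t) =
      -((W (t - 1) * Pp + Pm) * M t * (Pp + W t * Pm)) := fun t => by
    rw [hEinv t]
    have h := neg_explicitInv_mul_eq_dressed_two _ Pp Pm (Bh t) (A t - Bh t) (W (t - 1)) (W t) hPP hQQ hPQ hQP
      (hspin t).2.2.1 (hspin t).2.1 (hCpp t) (hspin t).2.2.2.2.2.1 (hdetBh t)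
    rw [add_sub_cancel] at h
    rw [← h, neg_neg]
  -- (4) the product of the one-step matrices
  have hprod : (-1 : ℂ) ^ L •
      ((List.range L).map fun i : ℕ =>
        (A (i : ZMod L) * Pm - Pp * W' ((i : ZMod L) - 1))⁻¹ *
          (A (i : ZMod L) * Pp - Pm * W (i : ZMod L))).prod =
      ((List.range L).map fun i : ℕ =>
        (W ((i : ZMod L) - 1) * Pp + Pm) * M i * (Pp + W i * Pm)).prod := by
    have hf : (fun i : ℕ => (A (i : ZMod L) * Pm - Pp * W' ((i : ZMod L) - 1))⁻¹ *
          (A (i : ZMod L) * Pp - Pm * W (i : ZMod L))) =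
        fun i : ℕ => -((W ((i : ZMod L) - 1) * Pp + Pm) * M i * (Pp + W i * Pm)) :=
      funext fun i => hstep i
    rw [hf, WilsonTransfer.prod_map_neg_eq_smul (fun i : ℕ => (W ((i : ZMod L) - 1) * Pp + Pm) * M i *
      (Pp + W i * Pm)) (List.range L), List.length_range, smul_smul, ← mul_pow, neg_mul_neg, one_mul, one_pow,
      one_smul]
  -- (5) the time-slice reduction (p118384) and the cyclic undressing (p119981)
  have hred : (wilsonDirac ρ U m 1).det =
      (∏ t : ZMod L, (A t * Pm - Pp * W' (t - 1)).det) *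
        (1 - (-1 : ℂ) ^ L •
          ((List.range L).map fun i : ℕ =>
            (A (i : ZMod L) * Pm - Pp * W' ((i : ZMod L) - 1))⁻¹ *
              (A (i : ZMod L) * Pp - Pm * W (i : ZMod L))).prod).det :=
    wilson_det_slice_reduction Nc L G ρ hρ U m hm
  have hcyc := det_one_sub_smul_prod_dressed _ L 1 Pp Pm M W hP hPP hQQ hPQ hQP
    (fun t => (hspin t).2.2.2.2.1) (fun t => (hspin t).2.2.2.2.2.1)
  rw [one_smul, one_smul] at hcyc
  refine ⟨?_, fun t => ?_⟩
  · rw [hred, hprod, hcyc]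
  · exact dressedCore_posDef _ Pp Pm (Bh t) (A t - Bh t) hP hPP hQQ hPQ hQP (hplus t).2.2.1 (hplus t).2.2.2.1
      (hspin t).2.2.1 (hspin t).2.1 (hplus t).2.1 (hplus t).2.2.2.2

end Summit.QuantumFields.QCD.Cruxes.StableActionBridge.Sketch

end
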